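import Summits.CriticalPhenomena.Ising3DConformalLimit.Theorems.MonotoneRGZoomGluePointwise
import Summits.CriticalPhenomena.Ising3DConformalLimit.Theorems.EnergyNotSigmaSquaredMoebiusLimitExistsCompactnessSchema
import Summits.CriticalPhenomena.Ising3DConformalLimit.Theorems.ExistsScaleCovariantLimit.Negative.TightnessUniqueness
import Summits.CriticalPhenomena.Ising3DConformalLimit.Theorems.HyperoctahedralRPExistsScaleCovariantLimitTwoHierarchies
import Summits.CriticalPhenomena.Ising3DConformalLimit.Theorems.HyperoctahedralRPExistsScaleCovariantLimitScaleCovariantOfTwoThree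
import Summits.CriticalPhenomena.Ising3DConformalLimit.Theorems.HyperoctahedralRPExistsScaleCovariantLimitPinnedLimitOfDyadic
import HarnessLib

/-!
# `ZoomGlue` (route `MonotoneRG`, item stmt-CriticalPhenomena-14455):
# `UniformRegularity → ZoomMonotone → ExistsScaleCovariantLimit`, by TWO PRIMES

Line `Sketch` (crux idea two-hierarchies-force-the-filter) of the existence crux `ExistsScaleCovariantLimit`
(item stmt-CriticalPhenomena-1981) reduces the crux to tightness of the pinned zoom plus UNIQUENESS of its
locally-uniform cluster points within the dyadic mesh family `2^{-k}` and within the triadic family `3^{-k}`.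
This file shows that route `MonotoneRG`'s two cruxes supply exactly that, and so proves its glue item 14455:
* `schemaTight`: `UniformRegularity` (item 4658) gives, along every mesh sequence, a subsequence along which
  the pinned zoom converges locally uniformly for all `n` to a family CONTINUOUS off the diagonals (the landed
  Arzelà–Ascoli schema `compactnessSchema`);
* `clusterPoints_eq_of_bAdic` (`b = 2, 3`): two continuous cluster points along subsequences of `b^{-k}`
  coincide — they agree at every `b`-adic rational configuration, where the whole geometric sequence
  converges (`tendsto_geomMesh_bAdic`, from `ZoomMonotone` + `UniformRegularity`, first half of this pair
  of files), and `b`-adic rationals are dense in the open set `NonCoincident`;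
* `dyadicConvergence`, `triadicConvergence`: the sub-subsequence argument then gives K1 (dyadic locally
  uniform convergence, to a continuous limit) and K2 (triadic pointwise convergence);
* `zoomGlue_proof`: K1 ∧ K2 ⟹ the crux, by the landed two-hierarchies theorems of line `Sketch`
  (`stub_twoHierarchies`, `stub_scaleCovariantOfTwoThree`, `stub_pinnedLimitOfDyadic`, `crux_of_pinnedLimit`).
So `ExistsScaleCovariantLimit ⟸ UniformRegularity ∧ ZoomMonotone` WITHOUT steps (3)–(6) of the item's plan
(no general-mesh interpolation, no equicontinuity transport of translations or dilations): `log 3/log 2 ∉ ℚ`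
does that work.

References: folklore (Arzelà–Ascoli, sub-subsequence principle); Hirsch–Smith 2005 Thm 1.4 (reading of
`ZoomMonotone`). No definitions are introduced.
-/

noncomputable section

namespace Summit.CriticalPhenomena.Ising3DConformalLimit.MonotoneRGZoomGlue

open Literature.Probability.LatticeModels Filter Set
open scoped Topology
open Summit.CriticalPhenomena.Ising3DConformalLimit.MoebiusLimitExistsOnlyInteraction (rhoPin compactnessSchema)
open Summit.CriticalPhenomena.Ising3DConformalLimit.ExistsScaleCovariantLimitNegative.Dyadic
open Summit.CriticalPhenomena.Ising3DConformalLimit.Theses.MonotoneRG (UniformRegularity ZoomMonotone)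
open Summit.CriticalPhenomena.Ising3DConformalLimit.Cruxes.ExistsScaleCovariantLimit.TwoHierarchies
  (dyadicLimit_cfg01 dyadicLimit_cfg0_two_pos dyadicLimit_cfg0_pos stub_twoHierarchies
    stub_scaleCovariantOfTwoThree stub_pinnedLimitOfDyadic)
open Summit.CriticalPhenomena.Ising3DConformalLimit.PinnedClusterPoints (cfg01_mem rescaled_pin_cfg01)

/-! ### Tightness with CONTINUOUS cluster points, from `UniformRegularity` -/

/-- **Schema tightness.** Under `UniformRegularity`, every mesh sequence `u k → 0⁺` in `(0,1]` has a
subsequence along which the pinned zoom converges, for all `n`, locally uniformly off the diagonals to a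
family that is continuous off the diagonals (`compactnessSchema`). [folklore] -/
theorem schemaTight (hUR : UniformRegularity) {u : ℕ → ℝ} (hu : Tendsto u atTop (𝓝[>] (0:ℝ))) :
    ∃ (φ : ℕ → ℕ) (S : CorrFamily 3), StrictMono φ ∧ (∀ n, ContinuousOn (S n) (NonCoincident 3 n)) ∧
      ∀ n, TendstoLocallyUniformlyOn (fun k => rescaledCorrelator (criticalCorr 3) rhoPin n (u (φ k)))
        (S n) atTop (NonCoincident 3 n) := by
  have hUR' := hUR
  unfold UniformRegularity at hUR'
  have hρ : (fun δ : ℝ => (criticalTwoPoint 3 (Pi.single 0 ⌊δ⁻¹⌋)) ^ (-(1/2:ℝ))) = rhoPin :=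
    funext fun δ => by simp only [rhoPin, one_div]
  rw [hρ] at hUR'
  have hev : ∀ {δ₀ : ℝ}, 0 < δ₀ → ∀ᶠ k in atTop, u k ∈ Set.Ioo 0 δ₀ := fun hδ₀ =>
    hu (Ioo_mem_nhdsGT hδ₀)
  obtain ⟨φ, S, hφ, -, hcont, hconv⟩ := compactnessSchema
    (fun n k x => rescaledCorrelator (criticalCorr 3) rhoPin n (u k) x)
    (fun n K hK hKs => by
      obtain ⟨M, δ₀, hδ₀, hM⟩ := (hUR'.1 n K hKs hK).1
      exact ⟨M, (hev hδ₀).mono fun k hk x hx => hM _ hk x hx⟩)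
    (fun n K hK hKs ε hε => by
      obtain ⟨r, δ₀, hr, hδ₀, hE⟩ := (hUR'.1 n K hKs hK).2 ε hε
      exact ⟨r, hr, (hev hδ₀).mono fun k hk x hx y hy hxy => hE _ hk x hx y hy hxy⟩)
  exact ⟨φ, S, hφ, hcont, hconv⟩

/-! ### `b`-adic rational approximation inside the open set `NonCoincident` -/

/-- The `b`-adic rational approximants `x⁽ᵐ⁾ᵢ = b^{-m}·[b^m xᵢ]` of a configuration. [folklore] -/
theorem tendsto_bAdicApprox {b : ℕ} (hb : 2 ≤ b) {n : ℕ} (x : Fin n → EuclideanSpace ℝ (Fin 3)) :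
    Tendsto (fun m : ℕ => fun i => ((b : ℝ) ^ m)⁻¹ • siteVec (latticeApprox (((b : ℝ) ^ m)⁻¹) (x i)))
      atTop (𝓝 x) := by
  rw [tendsto_pi_nhds]
  intro i
  rw [tendsto_iff_norm_sub_tendsto_zero]
  have hb1 : (1 : ℝ) < b := by exact_mod_cast (show 1 < b by omega)
  have hδ : Tendsto (fun m : ℕ => ((b : ℝ) ^ m)⁻¹) atTop (𝓝 0) :=
    tendsto_inv_atTop_zero.comp (tendsto_pow_atTop_atTop_of_one_lt hb1)
  have h2δ : Tendsto (fun m : ℕ => 2 * ((b : ℝ) ^ m)⁻¹) atTop (𝓝 0) := by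
    simpa using hδ.const_mul (2:ℝ)
  refine squeeze_zero (fun m => norm_nonneg _) (fun m => ?_) h2δ
  have hpos : (0 : ℝ) < ((b : ℝ) ^ m)⁻¹ := by positivity
  -- coordinatewise floor error `≤ δ`, Euclidean norm `≤ √3 δ ≤ 2δ`
  have hcoord : ∀ j, |(((b : ℝ) ^ m)⁻¹ • siteVec (latticeApprox (((b : ℝ) ^ m)⁻¹) (x i)) - x i) j| ≤
      ((b : ℝ) ^ m)⁻¹ := by
    intro j
    rw [PiLp.sub_apply, PiLp.smul_apply, siteVec_apply, smul_eq_mul]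
    exact abs_mul_latticeApprox_sub_le hpos (x i) j
  rw [EuclideanSpace.norm_eq]
  have hsum : ∑ j, ‖(((b : ℝ) ^ m)⁻¹ • siteVec (latticeApprox (((b : ℝ) ^ m)⁻¹) (x i)) - x i) j‖ ^ 2 ≤
      (2 * ((b : ℝ) ^ m)⁻¹) ^ 2 := by
    calc ∑ j, ‖(((b : ℝ) ^ m)⁻¹ • siteVec (latticeApprox (((b : ℝ) ^ m)⁻¹) (x i)) - x i) j‖ ^ 2
        ≤ ∑ _j : Fin 3, (((b : ℝ) ^ m)⁻¹) ^ 2 := Finset.sum_le_sum fun j _ => by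
            rw [Real.norm_eq_abs]
            exact pow_le_pow_left₀ (abs_nonneg _) (hcoord j) 2
      _ = 3 * (((b : ℝ) ^ m)⁻¹) ^ 2 := by simp
      _ ≤ (2 * ((b : ℝ) ^ m)⁻¹) ^ 2 := by nlinarith [sq_nonneg (((b : ℝ) ^ m)⁻¹)]
  calc Real.sqrt (∑ j, ‖(((b : ℝ) ^ m)⁻¹ • siteVec (latticeApprox (((b : ℝ) ^ m)⁻¹) (x i)) - x i) j‖ ^ 2)
      ≤ Real.sqrt ((2 * ((b : ℝ) ^ m)⁻¹) ^ 2) := Real.sqrt_le_sqrt hsum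
    _ = 2 * ((b : ℝ) ^ m)⁻¹ := Real.sqrt_sq (by positivity)

/-- The approximants have integer coordinates after dilation by `b^m`. [folklore] -/
theorem bAdicApprox_int (b m : ℕ) {n : ℕ} (x : Fin n → EuclideanSpace ℝ (Fin 3)) :
    ∀ i j, ∃ z : ℤ, (fun i => siteVec (latticeApprox (((b : ℝ) ^ m)⁻¹) (x i))) i j = (z : ℝ) :=
  fun i j => ⟨latticeApprox (((b : ℝ) ^ m)⁻¹) (x i) j, by simp⟩

/-! ### Uniqueness of CONTINUOUS cluster points along subsequences of `b^{-k}` (`b = 2, 3, …`) -/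

/-- **Two continuous cluster points of the pinned zoom along subsequences of the geometric meshes `b^{-k}`
coincide off the diagonals** (`UniformRegularity` + `ZoomMonotone`): at a `b`-adic rational non-coincident
configuration the whole sequence `k ↦ F_n(b^{-k})` converges (`tendsto_geomMesh_bAdic`), so both cluster
points take the value of that limit there; `b`-adic rationals are dense in the open set `NonCoincident 3 n`
and both cluster points are continuous on it. [folklore] -/
theorem clusterPoints_eq_of_bAdic (hUR : UniformRegularity) (hZM : ZoomMonotone) {b : ℕ} (hb : 2 ≤ b)
    {φ ψ : ℕ → ℕ} {S S' : CorrFamily 3} (hφ : StrictMono φ) (hψ : StrictMono ψ) {n : ℕ}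
    (hS : TendstoLocallyUniformlyOn
      (fun j : ℕ => rescaledCorrelator (criticalCorr 3) rhoPin n (((b : ℝ) ^ (φ j))⁻¹)) (S n) atTop
      (NonCoincident 3 n))
    (hS' : TendstoLocallyUniformlyOn
      (fun j : ℕ => rescaledCorrelator (criticalCorr 3) rhoPin n (((b : ℝ) ^ (ψ j))⁻¹)) (S' n) atTop
      (NonCoincident 3 n))
    (hc : ContinuousOn (S n) (NonCoincident 3 n)) (hc' : ContinuousOn (S' n) (NonCoincident 3 n))
    {x : Fin n → EuclideanSpace ℝ (Fin 3)} (hx : x ∈ NonCoincident 3 n) : S n x = S' n x := by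
  -- (1) agreement at every `b`-adic rational non-coincident configuration
  have hagree : ∀ (a : ℕ) (y : Fin n → EuclideanSpace ℝ (Fin 3)), (∀ i j, ∃ z : ℤ, y i j = (z : ℝ)) →
      (fun i => ((b : ℝ) ^ a)⁻¹ • y i) ∈ NonCoincident 3 n →
      S n (fun i => ((b : ℝ) ^ a)⁻¹ • y i) = S' n (fun i => ((b : ℝ) ^ a)⁻¹ • y i) := by
    intro a y hint hz
    obtain ⟨L, hL⟩ := tendsto_geomMesh_bAdic hUR hZM hb a hint hz
    have e1 : S n (fun i => ((b : ℝ) ^ a)⁻¹ • y i) = L :=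
      tendsto_nhds_unique (hS.tendsto_at hz) (hL.comp hφ.tendsto_atTop)
    have e2 : S' n (fun i => ((b : ℝ) ^ a)⁻¹ • y i) = L :=
      tendsto_nhds_unique (hS'.tendsto_at hz) (hL.comp hψ.tendsto_atTop)
    rw [e1, e2]
  -- (2) approximate `x` by `b`-adic rationals inside the open set `NonCoincident 3 n`
  set xm : ℕ → (Fin n → EuclideanSpace ℝ (Fin 3)) :=
    fun m i => ((b : ℝ) ^ m)⁻¹ • siteVec (latticeApprox (((b : ℝ) ^ m)⁻¹) (x i)) with hxm
  have hxm_t : Tendsto xm atTop (𝓝 x) := tendsto_bAdicApprox hb x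
  have hxm_mem : ∀ᶠ m in atTop, xm m ∈ NonCoincident 3 n :=
    hxm_t.eventually ((isOpen_nonCoincident 3 n).mem_nhds hx)
  have hxm_w : Tendsto xm atTop (𝓝[NonCoincident 3 n] x) :=
    tendsto_nhdsWithin_iff.2 ⟨hxm_t, hxm_mem⟩
  have hSx : Tendsto (fun m => S n (xm m)) atTop (𝓝 (S n x)) := (hc x hx).tendsto.comp hxm_w
  have hS'x : Tendsto (fun m => S' n (xm m)) atTop (𝓝 (S' n x)) := (hc' x hx).tendsto.comp hxm_w
  have heq : ∀ᶠ m in atTop, S n (xm m) = S' n (xm m) :=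
    hxm_mem.mono fun m hm => hagree m _ (bAdicApprox_int b m x) hm
  exact tendsto_nhds_unique hSx (hS'x.congr' (heq.mono fun m hm => hm.symm))

/-! ### K1 and K2 from schema tightness + uniqueness (sub-subsequence arguments) -/

/-- `b^{-k} ∈ (0,1]` and `b^{-k} → 0⁺` for `b ≥ 2`. [folklore] -/
theorem geomMesh_mem_and_tendsto {b : ℕ} (hb : 2 ≤ b) :
    (∀ k : ℕ, ((b : ℝ) ^ k)⁻¹ ∈ Set.Ioc (0:ℝ) 1) ∧
      Tendsto (fun k : ℕ => ((b : ℝ) ^ k)⁻¹) atTop (𝓝[>] (0:ℝ)) := by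
  have hb1 : (1 : ℝ) ≤ b := by exact_mod_cast (show 1 ≤ b by omega)
  have hb1' : (1 : ℝ) < b := by exact_mod_cast (show 1 < b by omega)
  refine ⟨fun k => ⟨by positivity, inv_le_one_of_one_le₀ (one_le_pow₀ hb1)⟩, ?_⟩
  refine tendsto_nhdsWithin_iff.2 ⟨?_, Eventually.of_forall fun k => Set.mem_Ioi.2 (by positivity)⟩
  exact tendsto_inv_atTop_zero.comp (tendsto_pow_atTop_atTop_of_one_lt hb1')

/-- **K1 (generalised to any base `b ≥ 2`): the pinned zoom converges along `b^{-k}`, all `n`, locally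
uniformly off the diagonals, to a limit continuous off the diagonals** (`UniformRegularity` +
`ZoomMonotone`). Sub-subsequence argument: a candidate limit from `schemaTight`; if uniform convergence
failed on a compact, a bad subsequence would have (schema) a further convergent subsequence whose continuous
limit equals the candidate (`clusterPoints_eq_of_bAdic`) — contradiction. [folklore] -/
theorem geomConvergence (hUR : UniformRegularity) (hZM : ZoomMonotone) {b : ℕ} (hb : 2 ≤ b) :
    ∃ S : CorrFamily 3, (∀ n, ContinuousOn (S n) (NonCoincident 3 n)) ∧ ∀ n : ℕ,
      TendstoLocallyUniformlyOn
        (fun k : ℕ => rescaledCorrelator (criticalCorr 3) rhoPin n (((b : ℝ) ^ k)⁻¹)) (S n) atTop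
        (NonCoincident 3 n) := by
  obtain ⟨-, hu⟩ := geomMesh_mem_and_tendsto hb
  obtain ⟨φ₀, S₀, hφ₀, hc₀, h₀⟩ := schemaTight hUR hu
  refine ⟨S₀, hc₀, fun n => ?_⟩
  rw [tendstoLocallyUniformlyOn_iff_forall_isCompact (isOpen_nonCoincident 3 n)]
  intro K hK hKc
  rw [Metric.tendstoUniformlyOn_iff]
  intro ε hε
  by_contra hnot
  obtain ⟨ψ, hψ, hbad⟩ := extraction_of_frequently_atTop (Filter.not_eventually.1 hnot)
  -- schema along the bad subsequence
  obtain ⟨φ₁, S₁, hφ₁, hc₁, h₁⟩ := schemaTight hUR (hu.comp hψ.tendsto_atTop)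
  have hψφ : StrictMono (ψ ∘ φ₁) := hψ.comp hφ₁
  -- the two continuous cluster points coincide on `NonCoincident 3 n`
  have heq : Set.EqOn (S₁ n) (S₀ n) (NonCoincident 3 n) := fun x hx =>
    clusterPoints_eq_of_bAdic hUR hZM hb hψφ hφ₀ (h₁ n) (h₀ n) (hc₁ n) (hc₀ n) hx
  have h₁' : TendstoLocallyUniformlyOn
      (fun j : ℕ => rescaledCorrelator (criticalCorr 3) rhoPin n (((b : ℝ) ^ (ψ (φ₁ j)))⁻¹)) (S₀ n) atTop
      (NonCoincident 3 n) := (h₁ n).congr_right heq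
  have hU := (tendstoLocallyUniformlyOn_iff_forall_isCompact (isOpen_nonCoincident 3 n)).1 h₁' K hK hKc
  obtain ⟨j, hj⟩ := (Metric.tendstoUniformlyOn_iff.1 hU ε hε).exists
  exact hbad (φ₁ j) hj

/-- **K2 (generalised): the pinned zoom converges POINTWISE along `b^{-k}` off the diagonals**, a
corollary of `geomConvergence`. [folklore] -/
theorem geomConvergence_pointwise (hUR : UniformRegularity) (hZM : ZoomMonotone) {b : ℕ} (hb : 2 ≤ b) :
    ∃ S : CorrFamily 3, ∀ n : ℕ, ∀ x ∈ NonCoincident 3 n,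
      Tendsto (fun k : ℕ => rescaledCorrelator (criticalCorr 3) rhoPin n (((b : ℝ) ^ k)⁻¹) x) atTop
        (𝓝 (S n x)) := by
  obtain ⟨S, -, hS⟩ := geomConvergence hUR hZM hb
  exact ⟨S, fun n x hx => (hS n).tendsto_at hx⟩

/-! ### Assembly: two primes fix the scale -/

/-- Dilating the axis pair: `c • (0, s e₀) = (0, (c s) e₀)`. [folklore] -/
theorem cfg0_smul'' (c s : ℝ) :
    (fun i => c • (![0, EuclideanSpace.single 0 s] : Fin 2 → EuclideanSpace ℝ (Fin 3)) i) =
      (![0, EuclideanSpace.single 0 (c * s)] : Fin 2 → EuclideanSpace ℝ (Fin 3)) := by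
  have h := smul_cfg01 (c * s)
  rw [← h, ← smul_cfg01 s]
  funext i
  simp [mul_smul]

/-- **Dyadic self-consistency is automatic**: any dyadic limit of the pinned zoom satisfies
`S n x = S₂(0, 2e₀)^{-n/2} · S n (2·x)` off the diagonals (the mesh `2^{-(k+1)}` is the mesh `2^{-k}` of
the doubled configuration, re-pinned; adapted from the standing disprover's `dyadicLimit_two_selfConsistent`).
[folklore] -/
theorem dyadicLimit_two_selfConsistent'' {S : CorrFamily 3}
    (hdy : ∀ n : ℕ, TendstoLocallyUniformlyOn
      (fun k : ℕ => rescaledCorrelator (criticalCorr 3) rhoPin n (((2:ℝ) ^ k)⁻¹)) (S n) atTop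
      (NonCoincident 3 n))
    {n : ℕ} {x : Fin n → EuclideanSpace ℝ (Fin 3)} (hx : x ∈ NonCoincident 3 n)
    (h2 : S 2 (![0, EuclideanSpace.single 0 2] : Fin 2 → EuclideanSpace ℝ (Fin 3)) ≠ 0) :
    S n x = (S 2 (![0, EuclideanSpace.single 0 2] : Fin 2 → EuclideanSpace ℝ (Fin 3))) ^ (-(n:ℝ) / 2) *
      S n (fun i => (2:ℝ) • x i) := by
  have hx2 : (fun i => (2:ℝ) • x i) ∈ NonCoincident 3 n := smul_mem_nonCoincident two_ne_zero hx
  have hid : ∀ k : ℕ, rescaledCorrelator (criticalCorr 3) rhoPin n (((2:ℝ) ^ (k + 1))⁻¹) x =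
      (rescaledCorrelator (criticalCorr 3) rhoPin 2 (((2:ℝ) ^ k)⁻¹)
        (![0, EuclideanSpace.single 0 2] : Fin 2 → EuclideanSpace ℝ (Fin 3))) ^ (-(n:ℝ) / 2) *
      rescaledCorrelator (criticalCorr 3) rhoPin n (((2:ℝ) ^ k)⁻¹) (fun i => (2:ℝ) • x i) := by
    intro k
    have h := pz_scale (s := 2) two_pos (dyad_pos k) n x
    have e : (2:ℝ)⁻¹ * ((2:ℝ) ^ k)⁻¹ = ((2:ℝ) ^ (k + 1))⁻¹ := by rw [pow_succ, mul_inv, mul_comm]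
    rw [e] at h
    exact h
  have hL : Tendsto (fun k : ℕ => rescaledCorrelator (criticalCorr 3) rhoPin n (((2:ℝ) ^ (k + 1))⁻¹) x)
      atTop (𝓝 (S n x)) :=
    ((hdy n).tendsto_at hx).comp (tendsto_add_atTop_nat 1)
  have hR : Tendsto (fun k : ℕ => (rescaledCorrelator (criticalCorr 3) rhoPin 2 (((2:ℝ) ^ k)⁻¹)
        (![0, EuclideanSpace.single 0 2] : Fin 2 → EuclideanSpace ℝ (Fin 3))) ^ (-(n:ℝ) / 2) *
      rescaledCorrelator (criticalCorr 3) rhoPin n (((2:ℝ) ^ k)⁻¹) (fun i => (2:ℝ) • x i))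
      atTop (𝓝 ((S 2 (![0, EuclideanSpace.single 0 2] : Fin 2 → EuclideanSpace ℝ (Fin 3))) ^
        (-(n:ℝ) / 2) * S n (fun i => (2:ℝ) • x i))) :=
    ((((hdy 2).tendsto_at (cfg0_mem (s := 2) two_ne_zero)).rpow_const (Or.inl h2))).mul
      ((hdy n).tendsto_at hx2)
  exact tendsto_nhds_unique hL (hR.congr fun k => (hid k).symm)

/-- **K1 ∧ K2 (with a continuous dyadic limit) ⟹ the pinned zoom converges along the full filter**
(the composition of line `Sketch`, from its landed stubs: two-hierarchies transfer, two-primes-fix-the-scale,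
dyadic-to-full-filter). [folklore] -/
theorem pinnedLimit_of_twoHierarchies' {S S' : CorrFamily 3}
    (hS : ∀ n : ℕ, TendstoLocallyUniformlyOn
      (fun k : ℕ => rescaledCorrelator (criticalCorr 3) rhoPin n (((2:ℝ) ^ k)⁻¹)) (S n) atTop
      (NonCoincident 3 n))
    (hcont : ∀ n : ℕ, ContinuousOn (S n) (NonCoincident 3 n))
    (hS' : ∀ n : ℕ, ∀ x ∈ NonCoincident 3 n,
      Tendsto (fun k : ℕ => rescaledCorrelator (criticalCorr 3) rhoPin n (((3:ℝ) ^ k)⁻¹) x) atTop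
        (𝓝 (S' n x))) :
    HasPointwiseScalingLimit (criticalCorr 3) rhoPin S := by
  have hC3 := stub_twoHierarchies S S' hS hcont hS'
  have h1 : S 2 (![0, EuclideanSpace.single 0 1] : Fin 2 → EuclideanSpace ℝ (Fin 3)) = 1 :=
    dyadicLimit_cfg01 hS
  have hA : 0 < S 2 (![0, EuclideanSpace.single 0 2] : Fin 2 → EuclideanSpace ℝ (Fin 3)) :=
    dyadicLimit_cfg0_two_pos hS
  have hC2 : ∀ n : ℕ, ∀ x ∈ NonCoincident 3 n,
      S n x = (S 2 (![0, EuclideanSpace.single 0 2] : Fin 2 → EuclideanSpace ℝ (Fin 3))) ^ (-(n:ℝ) / 2) *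
        S n (fun i => (2:ℝ) • x i) :=
    fun n x hx => dyadicLimit_two_selfConsistent'' hS hx hA.ne'
  have hB : 0 < S 2 (![0, EuclideanSpace.single 0 3] : Fin 2 → EuclideanSpace ℝ (Fin 3)) := by
    have hnn : 0 ≤ S 2 (![0, EuclideanSpace.single 0 3] : Fin 2 → EuclideanSpace ℝ (Fin 3)) :=
      ge_of_tendsto' ((hS 2).tendsto_at (cfg0_mem (by norm_num : (3:ℝ) ≠ 0)))
        fun k => (pz_two_cfg0_pos _ _).le
    rcases hnn.eq_or_lt with h0 | hpos
    · exfalso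
      have h := hC3 2 _ (cfg0_mem one_ne_zero)
      rw [cfg0_smul'', mul_one, h1, ← h0] at h
      norm_num at h
    · exact hpos
  obtain ⟨Δ, hsc⟩ := stub_scaleCovariantOfTwoThree S h1 hcont hA hB hC2 hC3
  exact stub_pinnedLimitOfDyadic S Δ hS hsc

/-- **`UniformRegularity ∧ ZoomMonotone ⟹ the pinned zoom converges along the full filter.** [folklore] -/
theorem pinnedLimit_of_UR_ZM (hUR : UniformRegularity) (hZM : ZoomMonotone) :
    ∃ S : CorrFamily 3, HasPointwiseScalingLimit (criticalCorr 3) rhoPin S := by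
  obtain ⟨S, hcont, hS⟩ := geomConvergence hUR hZM (b := 2) le_rfl
  obtain ⟨S', hS'⟩ := geomConvergence_pointwise hUR hZM (b := 3) (by norm_num)
  have hS2 : ∀ n : ℕ, TendstoLocallyUniformlyOn
      (fun k : ℕ => rescaledCorrelator (criticalCorr 3) rhoPin n (((2:ℝ) ^ k)⁻¹)) (S n) atTop
      (NonCoincident 3 n) := by
    intro n; have h := hS n; push_cast at h; exact h
  have hS3 : ∀ n : ℕ, ∀ x ∈ NonCoincident 3 n,
      Tendsto (fun k : ℕ => rescaledCorrelator (criticalCorr 3) rhoPin n (((3:ℝ) ^ k)⁻¹) x) atTop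
        (𝓝 (S' n x)) := by
    intro n x hx; have h := hS' n x hx; push_cast at h; exact h
  exact ⟨S, pinnedLimit_of_twoHierarchies' hS2 hcont hS3⟩

/-- **Item stmt-CriticalPhenomena-14455 (`MonotoneRG.ZoomGlue`):
`UniformRegularity → ZoomMonotone → ExistsScaleCovariantLimit`.** [folklore] -/
theorem zoomGlue_proof : Summit.CriticalPhenomena.Ising3DConformalLimit.Theses.MonotoneRG.ZoomGlue := by
  intro hUR hZM
  obtain ⟨S, hS⟩ := pinnedLimit_of_UR_ZM hUR hZM
  exact Summit.CriticalPhenomena.Ising3DConformalLimit.ExistsScaleCovariantLimitNegative.crux_of_pinnedLimit hS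

/-- The same conclusion for route `HyperoctahedralRP`'s copy of the shared existence crux (item 1981):
**`ExistsScaleCovariantLimit ⟸ UniformRegularity (4658) ∧ ZoomMonotone (14454)`**. [folklore] -/
theorem existsScaleCovariantLimit_of_UR_ZM (hUR : UniformRegularity) (hZM : ZoomMonotone) :
    Summit.CriticalPhenomena.Ising3DConformalLimit.Theses.HyperoctahedralRP.ExistsScaleCovariantLimit := by
  obtain ⟨S, hS⟩ := pinnedLimit_of_UR_ZM hUR hZM
  exact Summit.CriticalPhenomena.Ising3DConformalLimit.ExistsScaleCovariantLimitNegative.crux_of_pinnedLimit hS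

end Summit.CriticalPhenomena.Ising3DConformalLimit.MonotoneRGZoomGlue

end
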